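import Mathlib
import HarnessLib

/-!
# Kronecker bits V — the derivation skeleton of KB4's Taylor step: `D^{j} E₁ = (−1)^j j! E_{j+1}` from the weight ladder
# `D E_k = −k E_{k+1}`, equivariance under the scaling `z ↦ βz`, and the Taylor coefficients of the smoothed function
# `G_β = β E₁(β·) − N E₁` (seed crux `SignedMuSeedAtTwoPlus` stmt-BirchSwinnertonDyer-21438; parent Kμ⁺ stmt-BirchSwinnertonDyer-20689, route
# ResidualThetaTransportAtTwo; line card `Cruxes/SignedMuSeedAtTwoPlus/Lines/kronecker-bits.md`, stub KB4 / (T0b))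

Cell `bsd-wall`, width seat `bsd-wall-rtt-p4-w2` g16 (`--supports`, closes nothing).  THEOREMS ONLY; BSD is not proved by this.

`…KroneckerBitsGenerating.lean` takes the Taylor coefficients `(−1)^j (β^{j+1} E_{j+1}(βz_c) − N E_{j+1}(z_c))` of `G_β(z_c + w)` as its input shape.
This file derives that shape from three formal properties of the Eisenstein–Kronecker ladder (de Shalit II.3.1 (5): `E_k(z; L) = Σ (z+ω)^{−k}`
in the convergent range, so `(d/dz) E_k = −k E_{k+1}`; the chain rule for `z ↦ βz`; nothing else), over an arbitrary commutative `R`-algebra `A`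
of «functions» with an `R`-derivation `D` (informally `d/dz`) and an algebra endomorphism `S` (informally `f ↦ f(β·)`):

* **`iterate_derivation_weightLadder`** — `D (E k) = −k·E (k+1)` for all `k` ⇒ `D^[j] (E 1) = (−1)^j · j! · E (j+1)`;
* `derivation_neg_one_pow_mul_natCast` — `D((−1)^j · n) = 0`;
* **`iterate_derivation_scaling`** — `D (S f) = b • S (D f)` ⇒ `D^[j] (S f) = b^j • S (D^[j] f)` (chain rule for the scaling, iterated);
* `iterate_derivation_sub_smul` — iterates of `D` are linear on `b • x − N • y`;
* **`iterate_derivation_smoothed`** — for `Gβ := b • S (E 1) − N • E 1`: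
  `D^[j] Gβ = ((−1)^j j!) · (b^{j+1} • S (E (j+1)) − N • E (j+1))`, i.e. the `j`-th Taylor coefficient `D^[j] Gβ / j!` is
  `(−1)^j (b^{j+1} E_{j+1}(β·) − N E_{j+1})` — exactly the coefficient family of `fullOrbit_generating`.

[folklore]
-/

set_option autoImplicit false
-- the Theorems namespace of this sub repeats the summit name by design (D-0017 nested layout)
set_option linter.dupNamespace false

namespace Summit.BirchSwinnertonDyer.BirchSwinnertonDyer.Theorems.SignedMuAtTwo.KroneckerBits

section Taylor

variable {R A : Type*} [CommRing R] [CommRing A] [Algebra R A] (D : Derivation R A A)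

/-- A derivation kills the integer scalars `(−1)^j · n`. [folklore] -/
theorem derivation_neg_one_pow_mul_natCast (j n : ℕ) : D ((-1 : A) ^ j * (n : A)) = 0 := by
  rw [D.leibniz, D.map_natCast, smul_zero, zero_add, D.leibniz_pow, D.map_neg, Derivation.map_one_eq_zero,
    neg_zero, smul_zero, smul_zero, smul_zero]

/-- **The weight ladder, iterated**: if `D (E k) = −k · E (k+1)` for every `k` (informally `(d/dz) E_k(z; L) = −k E_{k+1}(z; L)`,
de Shalit II.3.1), then `D^[j] (E 1) = (−1)^j · j! · E (j+1)` — the Taylor expansion `E₁(z + w) = Σ_j (−1)^j E_{j+1}(z) w^j`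
(`j!` cancels). [folklore] -/
theorem iterate_derivation_weightLadder (E : ℕ → A) (hD : ∀ k : ℕ, D (E k) = -((k : A) * E (k + 1))) (j : ℕ) :
    D^[j] (E 1) = (-1 : A) ^ j * (j.factorial : A) * E (j + 1) := by
  induction j with
  | zero => simp
  | succ j ih =>
    rw [Function.iterate_succ_apply', ih, D.leibniz, derivation_neg_one_pow_mul_natCast, smul_zero, add_zero, hD,
      smul_eq_mul, Nat.factorial_succ]
    push_cast
    ring

/-- **Scaling equivariance, iterated** (chain rule for `z ↦ βz`): if `D (S f) = b • S (D f)` for all `f` then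
`D^[j] (S f) = b^j • S (D^[j] f)`. [folklore] -/
theorem iterate_derivation_scaling (S : A →ₐ[R] A) (b : R) (hDS : ∀ f, D (S f) = b • S (D f)) (j : ℕ) (f : A) :
    D^[j] (S f) = b ^ j • S (D^[j] f) := by
  induction j with
  | zero => simp
  | succ j ih =>
    rw [Function.iterate_succ_apply', ih, D.map_smul, hDS, smul_smul, ← pow_succ, Function.iterate_succ_apply']

/-- Iterates of a derivation are linear on the combination `b • x − N • y`. [folklore] -/
theorem iterate_derivation_sub_smul (b N : R) (x y : A) (j : ℕ) :
    D^[j] (b • x - N • y) = b • D^[j] x - N • D^[j] y := by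
  induction j with
  | zero => simp
  | succ j ih =>
    rw [Function.iterate_succ_apply', ih, D.map_sub, D.map_smul, D.map_smul, Function.iterate_succ_apply',
      Function.iterate_succ_apply']

/-- **Taylor coefficients of the smoothed function** `Gβ = b • S (E 1) − N • E 1` (informally `G_β(z) = β E₁(βz) − Nβ E₁(z)`,
de Shalit II.3.1 (7)): `D^[j] Gβ = ((−1)^j j!) · (b^{j+1} • S (E (j+1)) − N • E (j+1))`, i.e. `D^[j] Gβ / j!` is the coefficient
`(−1)^j (b^{j+1} E_{j+1}(β·) − N E_{j+1})` fed to `fullOrbit_generating`. [folklore] -/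
theorem iterate_derivation_smoothed (S : A →ₐ[R] A) (b N : R) (E : ℕ → A)
    (hD : ∀ k : ℕ, D (E k) = -((k : A) * E (k + 1))) (hDS : ∀ f, D (S f) = b • S (D f)) (j : ℕ) :
    D^[j] (b • S (E 1) - N • E 1)
      = (-1 : A) ^ j * (j.factorial : A) * (b ^ (j + 1) • S (E (j + 1)) - N • E (j + 1)) := by
  rw [iterate_derivation_sub_smul, iterate_derivation_scaling D S b hDS, iterate_derivation_weightLadder D E hD,
    map_mul, map_mul, map_pow, map_neg, map_one, map_natCast, smul_smul, ← pow_succ']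
  simp only [Algebra.smul_def, map_pow]
  ring

/-- Parity from scaling by `−1`: if `S₋` (informally `f ↦ f(−·)`) satisfies `D (S₋ f) = (−1) • S₋ (D f)` and `S₋ (E 1) = −E 1` (`E₁` odd),
then `j! · S₋ (E (j+1)) = j! · (−1)^{j+1} E (j+1)` — the parity `E_k(−z) = (−1)^k E_k(z)` up to the factor `j!`
(cancel it in characteristic `0`). [folklore] -/
theorem factorial_mul_scaling_neg_weight (S : A →ₐ[R] A) (E : ℕ → A)
    (hD : ∀ k : ℕ, D (E k) = -((k : A) * E (k + 1))) (hDS : ∀ f, D (S f) = (-1 : R) • S (D f))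
    (hodd : S (E 1) = -E 1) (j : ℕ) :
    (j.factorial : A) * S (E (j + 1)) = (j.factorial : A) * ((-1 : A) ^ (j + 1) * E (j + 1)) := by
  have h := iterate_derivation_scaling D S (-1) hDS j (E 1)
  rw [hodd] at h
  have hneg : D^[j] (-E 1) = -D^[j] (E 1) := by
    have h2 := iterate_derivation_sub_smul D 0 1 (E 1) (E 1) j
    simp only [zero_smul, one_smul, zero_sub] at h2
    exact h2
  rw [hneg, iterate_derivation_weightLadder D E hD, map_mul, map_mul, map_pow, map_neg, map_one, map_natCast] at h
  -- h : -((-1)^j * j! * E (j+1)) = (-1)^j • ((-1)^j * j! * S (E (j+1)))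
  have h1 : ((-1 : R) ^ j • ((-1 : A) ^ j * (j.factorial : A) * S (E (j + 1))))
      = (j.factorial : A) * S (E (j + 1)) := by
    rw [Algebra.smul_def, map_pow, map_neg, map_one, ← mul_assoc, ← mul_assoc, ← mul_pow, neg_mul_neg, one_mul, one_pow,
      one_mul]
  rw [h1] at h
  rw [← h]
  ring

end Taylor

end Summit.BirchSwinnertonDyer.BirchSwinnertonDyer.Theorems.SignedMuAtTwo.KroneckerBits
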